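import Summits.CriticalPhenomena.PercolationContinuityZ3.Theorems.PercNearOneGluingNoHeavyLowerTailAntipodalR1Reindex
import Summits.CriticalPhenomena.PercolationContinuityZ3.Theorems.PercNearOneGluingNoHeavyLowerTailAntipodalR1OneSumApexCut
import HarnessLib

/-!
# Tools for the irreducibility induction of ANTI₁-GRADED

Support file for `stmt-CriticalPhenomena-4575` (memo `prim-gen-kcluster/KCLUSTER-gen78.md` §1.5, §7 N1).
No definitions, no named facts, no sorries.  Vocabulary of `AntipodalR1` (gen 62) and the grade
`#components(open) + #components(closed)` of `…AntipodalR1NestedGraded`.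

* `card_lSet_grade_eq_of_equiv`, `card_rSet_grade_eq_of_equiv` — the level counts `#{x ∈ L, g x = t}`,
  `#{x ∈ R, g x = t}` are invariant under relabelling the edges along `e : ι' ≃ ι`;
* `card_lSet_grade_comm`, `card_rSet_grade_comm` — and symmetric in the two terminals (`R` via the
  global colour swap, which exchanges the two summands of the grade);
* `lSet_eq_empty_of_apex_eq_left/right`, `lSet_eq_empty_of_not_met_left/right/apex` — the degenerate
  placements have `L = ∅`; `card_lSet_grade_le_of_lSet_eq_empty`.
[this work]
-/

namespace Summit.CriticalPhenomena.PercolationContinuityZ3.Theorems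

namespace AntipodalR1

open Finset Relation SimpleGraph

universe u₀ u₁ u₂

variable {V : Type u₀} {ι : Type u₁} {ι' : Type u₂}

section Transport

variable [Fintype ι] [DecidableEq ι] [Fintype ι'] [DecidableEq ι']

open Classical in
/-- The level counts of `L` are invariant under relabelling the edges. [this work] -/
theorem card_lSet_grade_eq_of_equiv (e : ι' ≃ ι) (ends : ι → Sym2 V) (ends' : ι' → Sym2 V)
    (hends : ∀ i', ends' i' = ends (e i')) (a b c : V) (t : ℕ) :
    (univ.filter fun x' : ι' → Bool => x' ∈ lSet ends' a b c ∧
        (Nat.card (fromEdgeSet {s : Sym2 V | ∃ i, x' i = true ∧ ends' i = s}).ConnectedComponent +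
        Nat.card (fromEdgeSet {s : Sym2 V | ∃ i, x' i = false ∧ ends' i = s}).ConnectedComponent) =
          t).card =
      (univ.filter fun x : ι → Bool => x ∈ lSet ends a b c ∧
        (Nat.card (fromEdgeSet {s : Sym2 V | ∃ i, x i = true ∧ ends i = s}).ConnectedComponent +
        Nat.card (fromEdgeSet {s : Sym2 V | ∃ i, x i = false ∧ ends i = s}).ConnectedComponent) =
          t).card := by
  obtain rfl : ends' = ends ∘ e := funext hends
  rw [← Fintype.card_subtype, ← Fintype.card_subtype]
  refine Fintype.card_congr (Equiv.subtypeEquiv (Equiv.arrowCongr e (Equiv.refl Bool)) ?_)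
  intro x'
  have hx' : x' = (x' ∘ e.symm) ∘ e := by
    funext i; simp only [Function.comp_apply, Equiv.symm_apply_apply]
  have harr : (e.arrowCongr (Equiv.refl Bool)) x' = x' ∘ e.symm := by
    funext i; simp only [Equiv.arrowCongr_apply, Equiv.coe_refl, id_eq, Function.comp_apply]
  rw [harr]
  conv_lhs => rw [hx']
  rw [mem_lSet_comp_equiv, colGraph_comp_equiv, colGraph_comp_equiv]

open Classical in
/-- The level counts of `R` are invariant under relabelling the edges. [this work] -/
theorem card_rSet_grade_eq_of_equiv (e : ι' ≃ ι) (ends : ι → Sym2 V) (ends' : ι' → Sym2 V)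
    (hends : ∀ i', ends' i' = ends (e i')) (a b c : V) (t : ℕ) :
    (univ.filter fun x' : ι' → Bool => x' ∈ rSet ends' a b c ∧
        (Nat.card (fromEdgeSet {s : Sym2 V | ∃ i, x' i = true ∧ ends' i = s}).ConnectedComponent +
        Nat.card (fromEdgeSet {s : Sym2 V | ∃ i, x' i = false ∧ ends' i = s}).ConnectedComponent) =
          t).card =
      (univ.filter fun x : ι → Bool => x ∈ rSet ends a b c ∧
        (Nat.card (fromEdgeSet {s : Sym2 V | ∃ i, x i = true ∧ ends i = s}).ConnectedComponent +
        Nat.card (fromEdgeSet {s : Sym2 V | ∃ i, x i = false ∧ ends i = s}).ConnectedComponent) =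
          t).card := by
  obtain rfl : ends' = ends ∘ e := funext hends
  rw [← Fintype.card_subtype, ← Fintype.card_subtype]
  refine Fintype.card_congr (Equiv.subtypeEquiv (Equiv.arrowCongr e (Equiv.refl Bool)) ?_)
  intro x'
  have hx' : x' = (x' ∘ e.symm) ∘ e := by
    funext i; simp only [Function.comp_apply, Equiv.symm_apply_apply]
  have harr : (e.arrowCongr (Equiv.refl Bool)) x' = x' ∘ e.symm := by
    funext i; simp only [Equiv.arrowCongr_apply, Equiv.coe_refl, id_eq, Function.comp_apply]
  rw [harr]
  conv_lhs => rw [hx']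
  rw [mem_rSet_comp_equiv, colGraph_comp_equiv, colGraph_comp_equiv]

end Transport

section Symmetry

variable [Fintype ι] [DecidableEq ι]

open Classical in
/-- The level counts of `L` are symmetric in the two terminals. [this work] -/
theorem card_lSet_grade_comm (ends : ι → Sym2 V) (a b c : V) (t : ℕ) :
    (univ.filter fun x : ι → Bool => x ∈ lSet ends a b c ∧
        (Nat.card (fromEdgeSet {s : Sym2 V | ∃ i, x i = true ∧ ends i = s}).ConnectedComponent +
        Nat.card (fromEdgeSet {s : Sym2 V | ∃ i, x i = false ∧ ends i = s}).ConnectedComponent) =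
          t).card =
      (univ.filter fun x : ι → Bool => x ∈ lSet ends a c b ∧
        (Nat.card (fromEdgeSet {s : Sym2 V | ∃ i, x i = true ∧ ends i = s}).ConnectedComponent +
        Nat.card (fromEdgeSet {s : Sym2 V | ∃ i, x i = false ∧ ends i = s}).ConnectedComponent) =
          t).card := by
  rw [lSet_comm]

open Classical in
/-- The level counts of `R` are symmetric in the two terminals: the global colour swap maps
`R(b,c)` onto `R(c,b)` and exchanges the two summands of the grade. [this work] -/
theorem card_rSet_grade_comm (ends : ι → Sym2 V) (a b c : V) (t : ℕ) :
    (univ.filter fun x : ι → Bool => x ∈ rSet ends a b c ∧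
        (Nat.card (fromEdgeSet {s : Sym2 V | ∃ i, x i = true ∧ ends i = s}).ConnectedComponent +
        Nat.card (fromEdgeSet {s : Sym2 V | ∃ i, x i = false ∧ ends i = s}).ConnectedComponent) =
          t).card =
      (univ.filter fun x : ι → Bool => x ∈ rSet ends a c b ∧
        (Nat.card (fromEdgeSet {s : Sym2 V | ∃ i, x i = true ∧ ends i = s}).ConnectedComponent +
        Nat.card (fromEdgeSet {s : Sym2 V | ∃ i, x i = false ∧ ends i = s}).ConnectedComponent) =
          t).card := by
  -- the colour swap and its effect on membership and on the two edge sets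
  have hmem : ∀ (x : ι → Bool) (b c : V), x ∈ rSet ends a b c →
      (fun i => !x i) ∈ rSet ends a c b := by
    intro x b c hx
    obtain ⟨h1, h2, h3, h4⟩ := mem_rSet.1 hx
    refine mem_rSet.2 ⟨?_, ?_, ?_, ?_⟩
    · rw [mem_clus_flip]; exact h3
    · rw [mem_clus_flip]; exact h4
    · rw [mem_clus_flip]; exact h1
    · rw [mem_clus_flip]; exact h2
  have hT : ∀ x : ι → Bool, {s : Sym2 V | ∃ i, (fun i => !x i) i = true ∧ ends i = s} =
      {s : Sym2 V | ∃ i, x i = false ∧ ends i = s} := by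
    intro x; ext s; simp only [Set.mem_setOf_eq, Bool.not_eq_true']
  have hF : ∀ x : ι → Bool, {s : Sym2 V | ∃ i, (fun i => !x i) i = false ∧ ends i = s} =
      {s : Sym2 V | ∃ i, x i = true ∧ ends i = s} := by
    intro x; ext s; simp only [Set.mem_setOf_eq, Bool.not_eq_false']
  have hflip : ∀ x : ι → Bool, (fun i => !(fun i => !x i) i) = x := by
    intro x; funext i; simp only [Bool.not_not]
  refine Finset.card_bij (fun x _ => fun i => !x i) ?_ ?_ ?_
  · intro x hx
    rw [mem_filter] at hx ⊢
    refine ⟨mem_univ _, hmem x b c hx.2.1, ?_⟩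
    rw [hT, hF, Nat.add_comm]; exact hx.2.2
  · intro x _ y _ h
    have := congrArg (fun z : ι → Bool => fun i => !z i) h
    simpa only [hflip] using this
  · intro y hy
    rw [mem_filter] at hy
    refine ⟨fun i => !y i, ?_, hflip y⟩
    rw [mem_filter]
    refine ⟨mem_univ _, hmem y c b hy.2.1, ?_⟩
    rw [hT, hF, Nat.add_comm]; exact hy.2.2

end Symmetry

section Degenerate

/-- A vertex of a coloured cluster other than its root is met by an edge. [this work] -/
theorem exists_mem_ends_of_mem_clus {ends : ι → Sym2 V} {x : ι → Bool} {col : Bool} {a v : V}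
    (hv : v ∈ clus ends x col a) (hva : v ≠ a) : ∃ i, v ∈ ends i := by
  rw [mem_clus] at hv
  induction hv with
  | refl => exact absurd rfl hva
  | tail _ hw _ =>
    obtain ⟨i, -, hi⟩ := hw
    exact ⟨i, by rw [hi]; exact Sym2.mem_mk_right _ _⟩

/-- If the root is met by no edge, its coloured clusters are trivial. [this work] -/
theorem eq_of_mem_clus_of_not_met {ends : ι → Sym2 V} {x : ι → Bool} {col : Bool} {a v : V}
    (hv : v ∈ clus ends x col a) (ha : ∀ i, a ∉ ends i) : v = a := by
  rw [mem_clus] at hv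
  induction hv with
  | refl => rfl
  | tail _ hw ih =>
    obtain ⟨i, -, hi⟩ := hw
    subst ih
    exact absurd (by rw [hi]; exact Sym2.mem_mk_left _ _) (ha i)

variable [Fintype ι] [DecidableEq ι]

/-- `L(a; a, c) = ∅`: the apex lies in its own closed cluster. [this work] -/
theorem lSet_eq_empty_of_apex_eq_left (ends : ι → Sym2 V) (a c : V) : lSet ends a a c = ∅ := by
  classical
  refine filter_eq_empty_iff.2 fun x _ h => ?_
  exact h.2.1 (mem_clus.2 ReflTransGen.refl)

/-- `L(a; b, a) = ∅`. [this work] -/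
theorem lSet_eq_empty_of_apex_eq_right (ends : ι → Sym2 V) (a b : V) : lSet ends a b a = ∅ := by
  rw [lSet_comm]; exact lSet_eq_empty_of_apex_eq_left ends a b

/-- `L = ∅` if the left terminal is met by no edge (and is not the apex). [this work] -/
theorem lSet_eq_empty_of_not_met_left (ends : ι → Sym2 V) (a b c : V) (hba : b ≠ a)
    (hb : ∀ i, b ∉ ends i) : lSet ends a b c = ∅ := by
  classical
  refine filter_eq_empty_iff.2 fun x _ h => ?_
  obtain ⟨i, hi⟩ := exists_mem_ends_of_mem_clus h.1 hba
  exact hb i hi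

/-- `L = ∅` if the right terminal is met by no edge (and is not the apex). [this work] -/
theorem lSet_eq_empty_of_not_met_right (ends : ι → Sym2 V) (a b c : V) (hca : c ≠ a)
    (hc : ∀ i, c ∉ ends i) : lSet ends a b c = ∅ := by
  rw [lSet_comm]; exact lSet_eq_empty_of_not_met_left ends a c b hca hc

/-- `L = ∅` if the apex is met by no edge (and is not the left terminal). [this work] -/
theorem lSet_eq_empty_of_not_met_apex (ends : ι → Sym2 V) (a b c : V) (hba : b ≠ a)
    (ha : ∀ i, a ∉ ends i) : lSet ends a b c = ∅ := by
  classical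
  refine filter_eq_empty_iff.2 fun x _ h => ?_
  exact hba (eq_of_mem_clus_of_not_met h.1 ha)

open Classical in
/-- If `L = ∅`, every level inequality holds. [this work] -/
theorem card_lSet_grade_le_of_lSet_eq_empty (ends : ι → Sym2 V) (a b c : V)
    (h : lSet ends a b c = ∅) (t : ℕ) :
    (univ.filter fun x : ι → Bool => x ∈ lSet ends a b c ∧
        (Nat.card (fromEdgeSet {s : Sym2 V | ∃ i, x i = true ∧ ends i = s}).ConnectedComponent +
        Nat.card (fromEdgeSet {s : Sym2 V | ∃ i, x i = false ∧ ends i = s}).ConnectedComponent) =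
          t).card ≤
      (univ.filter fun x : ι → Bool => x ∈ rSet ends a b c ∧
        (Nat.card (fromEdgeSet {s : Sym2 V | ∃ i, x i = true ∧ ends i = s}).ConnectedComponent +
        Nat.card (fromEdgeSet {s : Sym2 V | ∃ i, x i = false ∧ ends i = s}).ConnectedComponent) =
          t).card := by
  rw [h, filter_eq_empty_iff.2 (fun x _ hx => Finset.notMem_empty x hx.1), card_empty]
  exact Nat.zero_le _

end Degenerate

end AntipodalR1

end Summit.CriticalPhenomena.PercolationContinuityZ3.Theorems
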